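import Mathlib

/-!
# Sliding-window products of linear forms (crux `ValuativeGCT.ValuativeFlip`, stub `stub_fourRowPencilRank`)

Part of the cyclic-tridiagonal architecture for hypothesis `H` of
`fourRowPencilRank_of_pencilCertificate` (`Cruxes/ValuativeFlip/AxisK9G1a2CyclicTridiagonal.md`,
§5b "P4-SIMPLE").  For a sequence `ρ : ZMod n → K` and two variables `i₀ ≠ i₁` the WINDOW PRODUCT of
length `f` starting at `q` is the binary form

  `swW ρ i₀ i₁ f q = ∏_{s < f} (X i₀ - ρ (q + s) • X i₁)`.

The strings of the cyclic tridiagonal pencil (`m_j ⋯ m_{j+e-1}`) and the all-monomer parts of its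
continuants (`l_{q+e+1} ⋯ l_{q-1}`) are window products, and the per-stratum rank bound of §5b
rests on one fact proved here:

* `sw_eval_pt` — evaluation at the point `X i₀ ↦ x`, all other variables `↦ 1`, is
  `∏_{s<f} (x - ρ (q+s))`; `sw_eval_pt_eq_zero` / `sw_eval_pt_ne_zero` — it vanishes at
  `x = ρ (q + s)`, `s < f`, and (for `ρ` injective, `f < n`) not at `x = ρ (q - 1)`;
* `sw_coeff_eq_zero_of_sum_eq_zero` — **consecutive windows are independent**: if scalars `d q`
  supported on the `j + 1 ≤ e + 1` consecutive starts `q₀, q₀+1, …, q₀+j` satisfy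
  `Σ_q d q • swW ρ i₀ i₁ e q = 0` then `d = 0` (downward induction: evaluating at
  `ρ (q₀ + j - 1)` kills the windows starting before `q₀ + j` and not the last one);
* `sw_coeff_eq_zero_of_sum_eq_zero_of_top_two` — hence a relation supported on `e + 3`
  consecutive starts whose top two coefficients vanish is trivial (the relation space of `e + 3`
  consecutive windows is at most `2`-dimensional — the form used by the strata bounds).

[folklore: products over sliding windows of distinct linear factors are a triangular family]
-/

set_option linter.dupNamespace false

namespace Summit.ValiantsHypothesis.ValiantsHypothesis.Theorems.ValuativeFlip

open MvPolynomial
open scoped BigOperators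

noncomputable section

/-- The window product `∏_{s<f} (X i₀ - ρ(q+s) • X i₁)` of `f` consecutive linear forms of the
sequence `r ↦ X i₀ - ρ r • X i₁` (indices in `ZMod n`), starting at `q`. [this crux] -/
def swW {K : Type*} [Field K] {σ : Type*} {n : ℕ} (ρ : ZMod n → K) (i₀ i₁ : σ) (f : ℕ) (q : ZMod n) : MvPolynomial σ K :=
  ∏ s ∈ Finset.range f, (X i₀ - C (ρ (q + s)) * X i₁)

/-- The evaluation point `X i₀ ↦ x`, every other variable `↦ 1`. [this crux] -/
def swPt {K : Type*} [Field K] {σ : Type*} [DecidableEq σ] (i₀ : σ) (x : K) : σ → K := fun i => if i = i₀ then x else 1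

/-- `swW` at the point `swPt i₀ x` is `∏_{s<f} (x - ρ(q+s))`. [this crux] -/
theorem sw_eval_pt {K : Type*} [Field K] {σ : Type*} {n : ℕ} [DecidableEq σ] (ρ : ZMod n → K) {i₀ i₁ : σ} (h : i₀ ≠ i₁) (f : ℕ)
    (q : ZMod n) (x : K) :
    MvPolynomial.eval (swPt i₀ x) (swW ρ i₀ i₁ f q) = ∏ s ∈ Finset.range f, (x - ρ (q + s)) := by
  unfold swW swPt
  rw [map_prod]
  refine Finset.prod_congr rfl fun s _ => ?_
  simp [h.symm]

/-- The window product starting at `q` vanishes at `x = ρ (q + s)` for `s < f`. [this crux] -/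
theorem sw_eval_pt_eq_zero {K : Type*} [Field K] {σ : Type*} {n : ℕ} [DecidableEq σ] (ρ : ZMod n → K) {i₀ i₁ : σ} (h : i₀ ≠ i₁) {f : ℕ}
    (q c : ZMod n) {s : ℕ} (hs : s < f) (hc : c = q + s) :
    MvPolynomial.eval (swPt i₀ (ρ c)) (swW ρ i₀ i₁ f q) = 0 := by
  rw [sw_eval_pt ρ h]
  exact Finset.prod_eq_zero (Finset.mem_range.mpr hs) (by rw [hc, sub_self])

/-- For `ρ` injective and `f < n`, the window product of length `f` starting at `q` does not
vanish at `x = ρ (q - 1)` (the index just before the window is not in it). [this crux] -/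
theorem sw_eval_pt_ne_zero {K : Type*} [Field K] {σ : Type*} {n : ℕ} [DecidableEq σ] {ρ : ZMod n → K} (hρ : Function.Injective ρ)
    {i₀ i₁ : σ} (h : i₀ ≠ i₁) {f : ℕ} (hf : f < n) (q : ZMod n) :
    MvPolynomial.eval (swPt i₀ (ρ (q - 1))) (swW ρ i₀ i₁ f q) ≠ 0 := by
  rw [sw_eval_pt ρ h]
  refine Finset.prod_ne_zero_iff.mpr fun s hs => ?_
  rw [sub_ne_zero]
  intro heq
  have hidx : q - 1 = q + s := hρ heq
  have hcast : ((s + 1 : ℕ) : ZMod n) = 0 := by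
    push_cast
    linear_combination hidx.symm
  rw [ZMod.natCast_eq_zero_iff] at hcast
  have := Nat.le_of_dvd (Nat.succ_pos s) hcast
  have := Finset.mem_range.mp hs
  omega

/-- **Consecutive windows are linearly independent.**  If `d : ZMod n → K` is supported on the
`j + 1` consecutive indices `q₀, …, q₀ + j` (`j ≤ e < n`) and `Σ_q d q • swW ρ i₀ i₁ e q = 0`, then
`d = 0` (evaluate at `ρ (q₀ + j - 1)`: the windows starting at `q₀ + t`, `t < j`, contain that index,
the one starting at `q₀ + j` does not; then induct downward on `j`). [folklore] -/
theorem sw_coeff_eq_zero_of_sum_eq_zero {K : Type*} [Field K] {σ : Type*} {n : ℕ} [NeZero n]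
    [DecidableEq σ] {ρ : ZMod n → K} (hρ : Function.Injective ρ) {i₀ i₁ : σ} (h : i₀ ≠ i₁) {e : ℕ}
    (he : e < n) (q₀ : ZMod n) : ∀ (j : ℕ), j ≤ e → ∀ (d : ZMod n → K),
    (∀ q, d q ≠ 0 → ∃ t : ℕ, t ≤ j ∧ q = q₀ + t) → ∑ q : ZMod n, d q • swW ρ i₀ i₁ e q = 0 → d = 0 := by
  intro j
  induction j with
  | zero =>
    intro _ d hsupp hrel
    -- only `q₀` can carry a nonzero coefficient
    have hd : ∀ q, q ≠ q₀ → d q = 0 := by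
      intro q hq
      by_contra hne
      obtain ⟨t, ht, rfl⟩ := hsupp q hne
      have : t = 0 := Nat.le_zero.mp ht
      subst this
      exact hq (by simp)
    have hsum : ∑ q : ZMod n, d q • swW ρ i₀ i₁ e q = d q₀ • swW ρ i₀ i₁ e q₀ := by
      rw [← Finset.add_sum_erase _ _ (Finset.mem_univ q₀)]
      rw [Finset.sum_eq_zero fun q hq => by rw [hd q (Finset.ne_of_mem_erase hq), zero_smul]]
      rw [add_zero]
    rw [hsum] at hrel
    have h0 : d q₀ = 0 := by
      have hev := congrArg (MvPolynomial.eval (swPt i₀ (ρ (q₀ - 1)))) hrel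
      rw [smul_eval, map_zero] at hev
      exact (mul_eq_zero.mp hev).resolve_right (sw_eval_pt_ne_zero hρ h he q₀)
    funext q
    by_cases hq : q = q₀
    · rw [hq, h0]; rfl
    · rw [hd q hq]; rfl
  | succ j ih =>
    intro hj d hsupp hrel
    -- Step 1: the top coefficient `d (q₀ + (j+1))` vanishes — evaluate at `ρ (q₀ + (j+1) - 1)`.
    set qt : ZMod n := q₀ + ((j + 1 : ℕ) : ZMod n) with hqt
    have htop : d qt = 0 := by
      have hev := congrArg (MvPolynomial.eval (swPt i₀ (ρ (qt - 1)))) hrel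
      rw [map_sum, map_zero] at hev
      rw [← Finset.add_sum_erase _ _ (Finset.mem_univ qt)] at hev
      have hrest : ∑ q ∈ Finset.univ.erase qt,
          MvPolynomial.eval (swPt i₀ (ρ (qt - 1))) (d q • swW ρ i₀ i₁ e q) = 0 := by
        refine Finset.sum_eq_zero fun q hq => ?_
        rw [smul_eval]
        by_cases hdq : d q = 0
        · rw [hdq, zero_mul]
        · obtain ⟨t, ht, rfl⟩ := hsupp q hdq
          have htj : t ≠ j + 1 := by
            rintro rfl
            exact Finset.ne_of_mem_erase hq rfl
          have htlt : t < j + 1 := lt_of_le_of_ne ht htj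
          -- the window starting at `q₀ + t` contains `qt - 1 = q₀ + t + (j - t)`
          rw [sw_eval_pt_eq_zero ρ h (q₀ + (t : ZMod n)) (qt - 1) (s := j - t) (by omega) ?_,
            mul_zero]
          rw [hqt]
          have hle : t ≤ j := by omega
          rw [Nat.cast_sub hle]
          push_cast
          ring
      rw [hrest, add_zero, smul_eval] at hev
      exact (mul_eq_zero.mp hev).resolve_right (sw_eval_pt_ne_zero hρ h he qt)
    -- Step 2: the support shrinks to `q₀, …, q₀ + j`; apply the induction hypothesis.
    refine ih (by omega) d ?_ hrel
    intro q hq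
    obtain ⟨t, ht, rfl⟩ := hsupp q hq
    rcases Nat.lt_or_ge t (j + 1) with hlt | hge
    · exact ⟨t, by omega, rfl⟩
    · exfalso
      have : t = j + 1 := le_antisymm ht hge
      subst this
      exact hq htop

/-- **Relations among `e + 3` consecutive windows with vanishing top two coefficients are
trivial** (the relation space of `e + 3` consecutive windows is at most `2`-dimensional): if `d` is
supported on `q₀, …, q₀ + e + 2`, `Σ_q d q • swW ρ i₀ i₁ e q = 0`, and
`d (q₀ + (e+1)) = d (q₀ + (e+2)) = 0`, then `d = 0`.  Needs `e + 3 ≤ n`. [folklore] -/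
theorem sw_coeff_eq_zero_of_sum_eq_zero_of_top_two {K : Type*} [Field K] {σ : Type*} {n : ℕ} [NeZero n] [DecidableEq σ] {ρ : ZMod n → K}
    (hρ : Function.Injective ρ) {i₀ i₁ : σ} (h : i₀ ≠ i₁) {e : ℕ} (he : e + 3 ≤ n) (q₀ : ZMod n)
    (d : ZMod n → K) (hsupp : ∀ q, d q ≠ 0 → ∃ t : ℕ, t ≤ e + 2 ∧ q = q₀ + t)
    (hrel : ∑ q : ZMod n, d q • swW ρ i₀ i₁ e q = 0)
    (h1 : d (q₀ + ((e + 1 : ℕ) : ZMod n)) = 0) (h2 : d (q₀ + ((e + 2 : ℕ) : ZMod n)) = 0) :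
    d = 0 := by
  refine sw_coeff_eq_zero_of_sum_eq_zero hρ h (by omega) q₀ e le_rfl d ?_ hrel
  intro q hq
  obtain ⟨t, ht, rfl⟩ := hsupp q hq
  rcases Nat.lt_or_ge t (e + 1) with hlt | hge
  · exact ⟨t, by omega, rfl⟩
  · exfalso
    rcases Nat.lt_or_ge t (e + 2) with hlt2 | hge2
    · have : t = e + 1 := by omega
      subst this; exact hq h1
    · have : t = e + 2 := by omega
      subst this; exact hq h2

end

end Summit.ValiantsHypothesis.ValiantsHypothesis.Theorems.ValuativeFlip
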